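import Summits.CriticalPhenomena.Ising3D.TaylorCoeffZMono
import Mathlib.Tactic.Linarith
import Mathlib.Tactic.Positivity
import Mathlib.Tactic.Ring
import Mathlib.Tactic.LinearCombination
import HarnessLib

/-!
# The q-polynomial form at the crossing-symmetric point: `2^{-E} 4^{-s} 2^{a+b} q(E, j, s; a, b)`
(cell `pub-ising3x`, seat boot-1; gate (g0′)/(g3) of the M3-γ milestone — the exact producer's target)

HONEST FRAMING: lottery ticket; floor = tightest certified 3D Ising CFT bounds; no exact-solution
claim without a proof.

At `x = ½` the factor germs of `TaylorCoeffZMono` lose their transcendental content up to an overall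
positive prefactor: `factor₁Germ s α ½ a = (½)^s (½)^α 2^a · q¹(s,α;a)` and
`factor₂Germ s α ½ a = (½)^s (½)^α 2^a · q²(s,α;a)` with the binomial sums
`q¹(s,α;a) = Σ_{i+i'=a} (-1)^i C(s,i) C(α,i')`, `q²(s,α;a) = Σ_{i+i'=a} C(s,i) (-1)^{i'} C(α,i')`
(`qFactor₁`, `qFactor₂`; polynomial in `(s, α)` with rational coefficients). Hence
(`taylorCoeffAt_crossF_zMono_half`)
`taylorCoeffAt ½ ½ (a,b) (crossF s σ 𝒫_{E,j}) = (½)^{2s} (½)^E 2^{a+b} · Σ_{p₁+p₂=j} λ_{p₁}λ_{p₂}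
   [q¹(s,τ+p₁;a) q¹(s,τ+p₂;b) + σ q²(s,τ+p₁;a) q²(s,τ+p₂;b)]`, `τ = (E-j)/2`,
i.e. every number a γ-certificate's region/head check needs is a POSITIVE prefactor `4^{-s} 2^{-E} 2^{a+b}`
times a rational-coefficient polynomial expression in `(E, j, s)` and the `λ_i = C(2i,i)/4^i` — the
q-polynomial tables of the cell's float probe (pub-ising3d `qpoly.py`), now a theorem about the typed
functional. Sources: Hogervorst–Rychkov 2013 §3 eq. (3.6); Kos–Poland–Simmons-Duffin 2014 §3.3.
-/

namespace Summit.CriticalPhenomena.Ising3D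

open Finset Set
open Literature.MathematicalPhysics.QuantumFieldTheory.ConformalBootstrap3D

/-- `q¹(s,α;a) = Σ_{i+i'=a} (-1)^i C(s,i) C(α,i')` (from `(1-z)^s z^α` at `z = ½`). [folklore] -/
noncomputable def qFactor₁ (s α : ℝ) (a : ℕ) : ℝ :=
  ∑ ij ∈ antidiagonal a, (-1) ^ ij.1 * Ring.choose s ij.1 * Ring.choose α ij.2

/-- `q²(s,α;a) = Σ_{i+i'=a} C(s,i) (-1)^{i'} C(α,i')` (from `z^s (1-z)^α` at `z = ½`). [folklore] -/
noncomputable def qFactor₂ (s α : ℝ) (a : ℕ) : ℝ :=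
  ∑ ij ∈ antidiagonal a, Ring.choose s ij.1 * ((-1) ^ ij.2 * Ring.choose α ij.2)

/-- `oneSubGerm α ½ i = (½)^α ((-1)^i C(α,i)) 2^i`. [folklore] -/
theorem oneSubGerm_half (α : ℝ) (i : ℕ) :
    oneSubGerm α (1 / 2) i = (1 / 2 : ℝ) ^ α * ((-1) ^ i * Ring.choose α i) * 2 ^ i := by
  rw [oneSubGerm_eq]
  norm_num

/-- `rpowGerm α ½ i = (½)^α C(α,i) 2^i`. [folklore] -/
theorem rpowGerm_half (α : ℝ) (i : ℕ) :
    rpowGerm α (1 / 2) i = (1 / 2 : ℝ) ^ α * Ring.choose α i * 2 ^ i := by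
  rw [rpowGerm_eq]
  have h1 : ((-1 : ℝ) ^ i) * ((-1 : ℝ) ^ i) = 1 := by
    rw [← mul_pow]; norm_num
  have h2 : (-(1 / 2 : ℝ)⁻¹) ^ i = (-1) ^ i * 2 ^ i := by
    rw [show (-(1 / 2 : ℝ)⁻¹) = (-1) * 2 by norm_num, mul_pow]
  rw [h2]
  linear_combination ((1 / 2 : ℝ) ^ α * Ring.choose α i * 2 ^ i) * h1

/-- **`factor₁Germ` at `½`**: `(½)^s (½)^α 2^a q¹(s,α;a)`. [folklore] -/
theorem factor₁Germ_half (s α : ℝ) (a : ℕ) :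
    factor₁Germ s α (1 / 2) a = (1 / 2 : ℝ) ^ s * (1 / 2 : ℝ) ^ α * 2 ^ a * qFactor₁ s α a := by
  unfold factor₁Germ qFactor₁
  rw [Finset.mul_sum]
  refine Finset.sum_congr rfl fun ij hij => ?_
  rw [oneSubGerm_half, rpowGerm_half, ← mem_antidiagonal.mp hij, pow_add]
  ring

/-- **`factor₂Germ` at `½`**: `(½)^s (½)^α 2^a q²(s,α;a)`. [folklore] -/
theorem factor₂Germ_half (s α : ℝ) (a : ℕ) :
    factor₂Germ s α (1 / 2) a = (1 / 2 : ℝ) ^ s * (1 / 2 : ℝ) ^ α * 2 ^ a * qFactor₂ s α a := by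
  unfold factor₂Germ qFactor₂
  rw [Finset.mul_sum]
  refine Finset.sum_congr rfl fun ij hij => ?_
  rw [rpowGerm_half, oneSubGerm_half, ← mem_antidiagonal.mp hij, pow_add]
  ring

/-- **(g0′) at the crossing-symmetric point: the q-polynomial form.** For `j ≤ E`, every `(a,b)`:
`taylorCoeffAt ½ ½ (a,b) (crossF s σ 𝒫_{E,j}) = (½)^{2s} (½)^E 2^{a+b} Σ_{p₁+p₂=j} λ_{p₁}λ_{p₂}
 (q¹(s,τ+p₁;a) q¹(s,τ+p₂;b) + σ q²(s,τ+p₁;a) q²(s,τ+p₂;b))`, `τ = (E-j)/2`.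
[cite: KosPolandSimmonsduffin2014, §3.3 eq. (3.17)] -/
theorem taylorCoeffAt_crossF_zMono_half (s σ E : ℝ) (j : ℕ) (hEj : (j : ℝ) ≤ E) (ab : ℕ × ℕ) :
    taylorCoeffAt (1 / 2) (1 / 2) ab (crossF s σ (zMono E j)) =
      (1 / 2 : ℝ) ^ (2 * s) * (1 / 2 : ℝ) ^ E * 2 ^ (ab.1 + ab.2) *
        ∑ p ∈ antidiagonal j, legendreLam p.1 * legendreLam p.2 *
          (qFactor₁ s ((E - (j : ℝ)) / 2 + p.1) ab.1 * qFactor₁ s ((E - (j : ℝ)) / 2 + p.2) ab.2 +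
            σ * (qFactor₂ s ((E - (j : ℝ)) / 2 + p.1) ab.1 * qFactor₂ s ((E - (j : ℝ)) / 2 + p.2) ab.2)) := by
  have hx0 : (0 : ℝ) < 1 / 2 := by norm_num
  have hx1 : (1 / 2 : ℝ) < 1 := by norm_num
  rw [taylorCoeffAt_crossF_zMono hx0 hx1 s σ E j hEj ab, Finset.mul_sum]
  refine Finset.sum_congr rfl fun p hp => ?_
  have hpj : (p.1 : ℝ) + p.2 = j := by exact_mod_cast mem_antidiagonal.mp hp
  have hs : (1 / 2 : ℝ) ^ s * (1 / 2 : ℝ) ^ s = (1 / 2 : ℝ) ^ (2 * s) := by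
    rw [← Real.rpow_add hx0]; ring_nf
  have hE : (1 / 2 : ℝ) ^ ((E - (j : ℝ)) / 2 + p.1) * (1 / 2 : ℝ) ^ ((E - (j : ℝ)) / 2 + p.2) =
      (1 / 2 : ℝ) ^ E := by
    rw [← Real.rpow_add hx0]
    congr 1
    linarith
  rw [factor₁Germ_half, factor₁Germ_half, factor₂Germ_half, factor₂Germ_half]
  set A := (1 / 2 : ℝ) ^ s
  set B₁ := (1 / 2 : ℝ) ^ ((E - (j : ℝ)) / 2 + p.1)
  set B₂ := (1 / 2 : ℝ) ^ ((E - (j : ℝ)) / 2 + p.2)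
  have key : legendreLam p.1 * legendreLam p.2 *
      (A * B₁ * 2 ^ ab.1 * qFactor₁ s ((E - (j : ℝ)) / 2 + p.1) ab.1 *
          (A * B₂ * 2 ^ ab.2 * qFactor₁ s ((E - (j : ℝ)) / 2 + p.2) ab.2) +
        σ * (A * B₁ * 2 ^ ab.1 * qFactor₂ s ((E - (j : ℝ)) / 2 + p.1) ab.1 *
          (A * B₂ * 2 ^ ab.2 * qFactor₂ s ((E - (j : ℝ)) / 2 + p.2) ab.2))) =
      (A * A) * (B₁ * B₂) * 2 ^ (ab.1 + ab.2) * (legendreLam p.1 * legendreLam p.2 *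
        (qFactor₁ s ((E - (j : ℝ)) / 2 + p.1) ab.1 * qFactor₁ s ((E - (j : ℝ)) / 2 + p.2) ab.2 +
          σ * (qFactor₂ s ((E - (j : ℝ)) / 2 + p.1) ab.1 * qFactor₂ s ((E - (j : ℝ)) / 2 + p.2) ab.2))) := by
    rw [pow_add]; ring
  rw [key, hs, hE]

/-- **Sign of the three certificate numbers = sign of the q-polynomials**: the prefactor
`(½)^{2s} (½)^E 2^{a+b}` is positive. [folklore] -/
theorem half_prefactor_pos (s E : ℝ) (a b : ℕ) :
    0 < (1 / 2 : ℝ) ^ (2 * s) * (1 / 2 : ℝ) ^ E * 2 ^ (a + b) := by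
  have h1 : 0 < (1 / 2 : ℝ) ^ (2 * s) := Real.rpow_pos_of_pos (by norm_num) _
  have h2 : 0 < (1 / 2 : ℝ) ^ E := Real.rpow_pos_of_pos (by norm_num) _
  positivity

end Summit.CriticalPhenomena.Ising3D
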